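import Mathlib
import HarnessLib
import HarnessLib.Audit
import Summits.AtomisticToContinuum.Statement
import Literature.MathematicalPhysics.KineticTheory.LangevinChainNESSHolds
import Summits.AtomisticToContinuum.FouriersLaw.Theorems.EmbeddedDrudeMourreNessUnique
import HarnessLib.Audit.Status.Attr

/-!
Route: JunctionLocality

DORMANT since 2026-08-26T08:25:10Z (reconciler: no traction for 8.4 d (last activity item-evidence-added at 2026-08-17T21:58:01Z); parked, not closed — `ledger route dormant route-AtomisticToContinuum-JunctionLocality --off` to reactiva) — unstaffed, not closed; items shared with open routes are served there. `ledger route dormant <id> --off` reactivates.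

# Route JunctionLocality — superadditive junction locality — κ exists finite from one certificate,
ballistic-or-Fourier dichotomy

X = (A) ∧ (B) ∧ (C) ("it suffices to show"), realising idea card superadditive-junction-dichotomy
(spine) and its twin
insertion-cost-superadditive-half; CONFORMING RE-OPEN (D-0027 §2.1) of route SuperadditiveJunction,
retired 2026-08-15T13:47Z
because its Assembly named the Literature constant and carried no proved deciding theorem. Fix
pinnedChain ω₂ lam β γ (all > 0)
and T > 0; D_N(T) = lim_{δ→0,δ≠0} totalCurrent(μ_{N,T+δ/2,T−δ/2})/δ is the finite-N response
coefficient of clause (ii) of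
OscillatorChain.FouriersLawFor along the (unique) weak steady-state family, R_N := (N−1)/D_N (N ≥ 2)
the end-to-end
linear-response RESISTANCE (= δT/J_N). (A) SuperadditiveResistance [rank 2, the bet]: ∃ C(T) ∀ N, M
≥ 2, R_{N+M} ≥ R_N + R_M − C
— R_N + R_M is exactly the resistance of the (N+M)-chain cut at bond (N−1,N) with both new ends
re-thermalised by Langevin baths at
the self-consistent temperature, so (A) says a thermalising cut never raises resistance by more than
a contact constant.
(B) NonBallistic [rank 3, necessary]: liminf_N D_N/(N−1) = 0; given (A) with explicit C it is ONE
finite-size certificate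
R_{N₀} > C. (C) ConductanceLowerBound [rank 4, necessary]: liminf_N D_N > 0. GLUE (theorem `closes`,
PROVED sorry-free, planner
folder glue.lean; real-analysis lemma SuperadditiveFekete also PROVED sorry-free in the folder,
Fekete.lean): a_N := R_N − C is
superadditive on {N ≥ 2}, Fekete gives R_N/N → ℓ = sup a_N/N, (B) gives ℓ > 0, (C) gives ℓ < ∞, so
D_N → κ(T) := 1/ℓ ∈ (0,∞);
clause (i) from the PROVED fact pinnedChain_exists_isSteadyState + NessUnique; uniqueness transfers
the δ-limits to every
steady-state family; the conclusion is the sub-problem Statement decl `FouriersLaw`.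
Lean: `SuperadditiveResistance ∧ NonBallistic ∧ ConductanceLowerBound`

## Assembly
Pure logic plus the real-analysis item SuperadditiveFekete; PROVED as `theorem closes` (planner
folder glue.lean = Sketch.lean,
lean check rc 0, axioms propext/Classical.choice/Quot.sound, ~60 lines): fix parameters > 0; clause
(i): existence from the proved
fact pinnedChain_exists_isSteadyState
(Literature.MathematicalPhysics.KineticTheory.LangevinChainNESSHolds), uniqueness from NessUnique;
clause (ii): choose the canonical family μ₀ (choice from existence, junk at non-positive
temperatures); for T > 0,
FiniteResponseOfUnique gives D⁰_N(T) for every N (choice); PositiveConductance,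
ConductanceLowerBound, SuperadditiveResistance
(fed the positivity) and NonBallistic applied to (μ₀, T, D⁰(T)) are exactly the hypotheses of
SuperadditiveFekete, yielding
κ_T > 0 with D⁰(T) → κ_T; set κ T := κ_T for T > 0 (else 1); for an arbitrary steady-state family μ,
uniqueness gives
μ N a b = μ₀ N a b for a, b > 0, so the difference quotients agree for |δ| < 2T and D⁰(T) serves as
its response sequence
(Filter.Tendsto.congr'). Conclusion: the sub-problem Statement decl `FouriersLaw` (by name).

Rationale: WHY THIS LINE. Every route to clause (ii) must control "the dependence of D on L"
(BonettoLebowitzReyBellet2000 §6.3; barrier HasBoundedResponse,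
necessary by hasBoundedResponse_of_fouriersLawFor). Instead of an N-uniform analytic estimate on ONE
chain (Green–Kubo decay,
hypocoercive rates, hydrodynamic closure — open or catalogued as blocked), this line compares THREE
finite chains (N, M, N+M) that
differ by a local surgery and lets superadditivity manufacture the N → ∞ statement (Fekete); (B) and
(C) are necessary halves of
0 < κ < ∞, so all risk beyond the conjunct sits in (A), whose content is the 1/N finite-size RATE
(D_N ≥ κ − O(1/N)). Imported
areas, with dictionary: finite-size criteria / superadditive ergodic architecture of percolation and
stochastic homogenisation
(Hammersley1988 mesoadditivity; ArmstrongKuusiMourrat2019 Ch. 2: box ↦ segment, dual quantity ν* ↦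
R_N − C, one good box ↦ one N₀
with R_{N₀} > C; Knabe1988 finite-size gap criterion as the spectral analogue); mesoscopic series
resistors with a thermalising
probe (Buttiker1986; BodineauDerrida2004 additivity principle = the large-deviation cousin, verified
for a deterministic anharmonic
crystal in doi:10.1103/physrevlett.107.250601; self-consistent reservoirs
BonettoLebowitzLukkarinenOlla2009); proof arena for (A):
two-sided Dirichlet/Thomson saddle representations of D_N = T⁻²⟨J,(−L)⁻¹J⟩ for the non-reversible
hypoelliptic L = A_H + γS
(GaudilliereLandim2013, LandimMarianiSeo2018; finite-volume Kubo formula ReyBellet2003 Rem 4.4,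
KunduDharNarayan2009) plus a
JUNCTION-REPAIR step on O(1) sites; certified computation (moment/SOS bounds doi:10.1137/16m107801x,
doi:10.1137/15m1053347) for
the single certificate in (B). BLR's order of limits is kept; no infinite-volume dynamics, local
equilibrium, relaxation rate or
κ = κ_GK identification is used (this separates the line from FourierGreenKubo, KineticCorner,
OddSectorIrreversibility,
CurrentTiltQuench); BondHeatUncertainty bounds D_N from above by a fluctuation relation but imports
exactly the
positive-or-infinite limit this route's engine produces.

RANKED CRUXES. #2 SuperadditiveResistance (crux) — under weak-NESS uniqueness, for every
steady-state family of pinnedChain ω₂ lam β γ (all > 0), every T > 0 and response coefficients D_N >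
0 (N ≥ 2): ∃ C = C(ω₂,lam,β,γ,T) with R_{N+M} ≥ R_N + R_M − C for all N, M ≥ 2, R_N := (N−1)/D_N
(card item K1; = InsertionCost of insertion-cost-superadditive-half). Bounded reservoir-insertion
cost: cutting the chain and re-thermalising the cut raises the end-to-end resistance by at most a
contact constant. Arena: Dirichlet/Thomson saddle representation of D_N for L = A_H + γS_baths + a
junction-repair lemma gluing near-optimal admissible pairs of the two bathed halves across the
deterministic bond at cost ≤ C uniformly in N, M (admissible classes are bulk-invariant,
arXiv:1105.0493 §6); other engines: thermostat interpolation at the junction, contact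
cross-correlations. NOT implied by FouriersLaw (it carries the 1/N rate): the bet. Trivial at lam =
β = 0 (HarmonicCalibration). [difficulty: XL] (why it might fail: Repair cost may grow with N, M if
optimal response fields carry junction-crossing coherent structure at all scales (long mean free
path; C(T)↑∞ as T→0 must be allowed); no sign principle is known (dephasing-assisted transport
exists); finite-size corrections slower than 1/N would kill it.) [GaudilliereLandim2013,
LandimMarianiSeo2018, arXiv:1105.0493, ReyBellet2003, KunduDharNarayan2009, Buttiker1986,
BodineauDerrida2004, BonettoLebowitzLukkarinenOlla2009, doi:10.1103/physrevlett.107.250601,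
LepriLiviPoliti2003]
#3 NonBallistic (crux) — under weak-NESS uniqueness, for every steady-state family of pinnedChain ω₂
lam β γ (all > 0), T > 0 and the response coefficients D_N: for every ε > 0 there are arbitrarily
long chains with D_N ≤ ε(N−1), i.e. the conductance G_N = D_N/(N−1) = J_N/δT is not bounded away
from 0 (card item K2). NECESSARY for the conjunct (FouriersLawFor ⇒ HasBoundedResponse ⇒ G_N → 0): a
refutation refutes FouriersLaw itself. Two ways in: (a) CERTIFICATE — once (A) holds with an
explicit C(T), this item is equivalent (given D_N > 0) to ONE N₀ ≥ 2 with (N₀−1)/D_{N₀}(T) > C(T),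
decidable by certified two-sided bounds on the stationary linear response of a 2N₀-dimensional
hypoelliptic polynomial diffusion (moment/SOS relaxations of ∫ L f dμ = 0); by the scaling conjugacy
D_N(T; lam, β) = D_N(1; lamT, βT) one expects N₀(T) → ∞ as T → 0, so '∀ T' needs compact-T families
plus asymptotics; (b) SOFT — an ergodic argument that ballistic conduction at every length forces a
non-thermal single-contact state (card single-thermostat-rigidity), or the light-cone fluctuation
bound of route BondHeatUncertainty (its TransferToNonBallistic discharges exactly this signature).
Fails, correctly, for the harmonic member (HarmonicCalibration). [difficulty: XL] (why it might
fail: A hidden conserved quantity / near-integrable member (Mazur1969; integrable dimer points)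
would make the chain a perfect conductor — then FouriersLaw is false too; proof-wise nothing gives
J_N → 0 for ANY deterministic anharmonic chain (BLR2000 §6.3), and certificates need (A) with
explicit C.) [BonettoLebowitzReyBellet2000, CanestrariLiveraniOlla2026, Mazur1969, RoyDhar2008,
doi:10.1137/16m107801x, doi:10.1137/15m1053347]
#4 ConductanceLowerBound (crux) — under weak-NESS uniqueness, for every steady-state family of
pinnedChain ω₂ lam β γ (all > 0), T > 0 and the response coefficients D_N: ∃ c = c(ω₂,lam,β,γ,T) > 0
and N₁ with D_N ≥ c for all N ≥ N₁ (liminf_N D_N > 0; an Ohmic LOWER bound J_N ≥ c·δT/(N−1) to first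
order; card item K3's positivity half). NECESSARY for the conjunct (D_N → κ(T) > 0). In the glue it
caps the Fekete slope (R_N/N ≤ 1/c), i.e. κ ≥ c. No N-uniform lower bound on the NESS current of a
deterministic anharmonic chain is in print; candidate engines: linear-response fluctuation-theorem /
uncertainty bounds, comparison with the energy-conserving-noise chain where κ ≥ c is a theorem
(BernardinOlla2005, BasileBernardinOlla2009), multi-scale pigeonhole on the response temperature
profile (card anti-insulator-kink-rigidity); ALTERNATIVE SUPPLIER: the companion SUBadditive half
(card fekete-resistance-subadditivity: R_{N+M} ≤ R_N + R_M + C' and D_2 > 0 give R_N ≤ K·N, hence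
D_N ≥ 1/(2K)). [difficulty: XL] (why it might fail: Asymptotic localisation (DeRoeckHuveneers2015)
makes c(T) super-polynomially small at fixed T — allowed — but a genuine thermal insulator (D_N → 0)
would refute the conjunct; no N-uniform lower bound for a deterministic chain's NESS current exists
in print.) [DeRoeckHuveneers2015, BernardinOlla2005, BasileBernardinOlla2009,
BonettoLebowitzReyBellet2000, LepriLiviPoliti2003, Dhar2008]
#9 NessUnique (support) — SHARED verbatim with BondHeatUncertainty / CurrentTiltQuench /
OddSectorIrreversibility / FourierGreenKubo: UNIQUENESS of the weak steady state (IsSteadyState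
class: probability measure, ∫ L f dμ = 0 for f ∈ C_c^∞, bond currents integrable) of pinnedChain ω₂
lam β γ (all > 0) for every N and T_L, T_R > 0. Existence is the PROVED fact
CuneoEckmannHairerReyBellet2018_pinnedChain_holds / pinnedChain_exists_isSteadyState (N = 0
included), so with this item clause (i) of FouriersLawFor holds. Content: uniqueness of the
invariant measure (CuneoEckmannHairerReyBellet2018 Thm 2.13, Carmona2007: smooth positive density by
hypoellipticity + control) plus identification of weak stationary probability solutions of L*μ = 0
with P_t-invariant measures for this hypoelliptic L with cubic drift (well-posed C_c^∞ martingale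
problem, EthierKurtz1986 Thm 4.9.17 / Echeverría's theorem, non-explosion via e^(θH)) — the
FP-identification lemma is the formal crux. N = 0: PhaseSpace 0 is a point; N = 1: both baths act on
the single site. [difficulty: L] [CuneoEckmannHairerReyBellet2018, Carmona2007, EthierKurtz1986,
ReyBelletThomas2002]
#9 FiniteResponseOfUnique (support) — SHARED verbatim (stmt-AtomisticToContinuum-0717 of
FourierGreenKubo and its siblings): assuming uniqueness of weak steady states for pinnedChain at all
N, T_L, T_R > 0, for every steady-state family, every T > 0 and every N the finite-N linear-response
limit D_N(T) = lim_{δ→0, δ≠0} totalCurrent(μ_{N,T+δ/2,T−δ/2})/δ exists. Content: differentiability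
at equilibrium of NESS expectations of the polynomial currents in the bath temperatures
(ReyBellet2003 Rem 4.4 (51)–(56) finite-volume Green–Kubo; HairerMajda2009 Thm 2.3 framework,
verifying its Assumptions 1–3 via CuneoEckmannHairerReyBellet2018 (2.5) / Carmona2007 weighted
spectral gap). N = 0, 1: totalCurrent ≡ 0, D = 0. [difficulty: L] [ReyBellet2003, HairerMajda2009,
CuneoEckmannHairerReyBellet2018, Carmona2007]
#9 PositiveConductance (support) — POSITIVE CONDUCTANCE AT EVERY FINITE LENGTH (fixed-N analysis):
under weak-NESS uniqueness, for every steady-state family, T > 0 and response coefficients D, D_N(T)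
> 0 for all N ≥ 2. Content: the finite-volume Kubo / fluctuation formula D_N = (N−1)T⁻² ∫₀^∞ ⟨j_b(0)
Σ_i j_i(t)⟩_eq dt = lim_t Var(Q_t)/(2tT²) ≥ 0 (ReyBellet2003 Rem 4.4 (56); KunduDharNarayan2009 for
Langevin baths) is NON-DEGENERATE — the time-integrated boundary energy current is not an
L²-coboundary of the equilibrium dynamics; equivalently strict positivity of entropy production at
T_L ≠ T_R (EckmannPilletReyBellet1999b) survives at first order in δT. Needed so that R_N =
(N−1)/D_N is a resistance in (A) and in the Fekete step. Fixed-N toolbox: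
CuneoEckmannHairerReyBellet2018 Thm 2.13, Carmona2007, HairerMajda2009. [difficulty: M]
[ReyBellet2003, KunduDharNarayan2009, EckmannPilletReyBellet1999b, CuneoEckmannHairerReyBellet2018]
#9 SuperadditiveFekete (support) — FEKETE GLUE (pure real analysis), PROVED sorry-free in the
planner folder (Fekete.lean, theorem superadditiveFekete_holds, axioms
propext/Classical.choice/Quot.sound, ~170 lines; attached as evidence — copy into Theorems/): for a
real sequence D with D_N > 0 (N ≥ 2), eventually D_N ≥ c > 0, resistances R_N := (N−1)/D_N
superadditive up to the constant C on {N, M ≥ 2}, and D_N ≤ ε(N−1) frequently for every ε > 0, the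
sequence D converges to some κ > 0. Proof: a_N := R_N − C satisfies a_{N+M} ≥ a_N + a_M (N, M ≥ 2);
k·a_n + a_r ≤ a_{kn+r} (n, r ≥ 2) along each residue class gives liminf a_N/N ≥ a_n/n, so a_N/N → ℓ
:= sup_{n≥2} a_n/n (bounded above by 1/c + |C| beyond N₁, finitely many before); non-ballisticity
with ε = 1/(|C|+1) gives some a_{N₀} > 0, so ℓ > 0; then R_N/N → ℓ and D_N = ((N−1)/N)/(R_N/N) → 1/ℓ
=: κ > 0. It is the hypothesis hF of `closes`. [difficulty: provable-now] [Hammersley1988,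
ArmstrongKuusiMourrat2019]
#9 JunctionDichotomy (support) — JUNCTION DICHOTOMY WITH RATE (pure real analysis; the route's
refutation interface and bonus theorem): if D_N > 0 for N ≥ 2 and R_N := (N−1)/D_N satisfies
TWO-SIDED locality |R_{N+M} − R_N − R_M| ≤ C (N, M ≥ 2), then EITHER ∃ κ > 0, K with |D_N − κ| ≤ K/N
for all N ≥ 2 (Fourier's law with the 1/N finite-size rate) OR D_N ≥ (N−1)/C for all N ≥ 2
(ballistic branch: bounded resistance, where pinnedChain ω₂ 0 0 γ sits). Proof: R_N − C
superadditive and R_N + C subadditive on {N ≥ 2} give R_N/N → ℓ with |R_N − Nℓ| ≤ C for every N ≥ 2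
and ℓ ≥ 0; ℓ = 0: 0 < R_N ≤ C; ℓ > 0, κ := 1/ℓ: |D_N − κ| ≤ 2(C + ℓ)/(ℓ²N) once Nℓ ≥ 2C, finitely
many N absorbed into K. So anomalous scalings D_N ~ N^α (0 < α < 1) and localisation are excluded
structurally by two-sided locality; pinned anharmonic chains numerically show exactly 1/N
corrections (boundary jumps: LepriLiviPoliti2003 §6, AokiKusnezov2001) — the cheapest consistency
check of the line. The subadditive half is the crux of the companion card
fekete-resistance-subadditivity. [difficulty: provable-now] [LepriLiviPoliti2003, AokiKusnezov2001,
Hammersley1988]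
#9 HarmonicCalibration (support) — HARMONIC CALIBRATION (sign/normalisation regression test at the
integrable corner, provable in tree): for the pinned HARMONIC chain pinnedChain ω₂ 0 0 γ (ω₂, γ > 0)
there is a steady-state family for all N, T_L, T_R > 0 (harmonicNESS, isSteadyState_harmonicNESS)
along which, at every T > 0, the response limits exist and equal D_N = (N−1)·fluxCoeff ω₂ γ N
(integral_bondCurrent_harmonicNESS_eq_fluxCoeff: every bond carries fluxCoeff·(T_L − T_R)), D_N > 0
for N ≥ 2 (fluxCoeff_eq with 0 < rootR < 1), the resistances R_N = 1/fluxCoeff_N satisfy TWO-SIDED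
junction locality (with C = 3·sup_N 1/fluxCoeff_N < ∞ since fluxCoeff_N → fluxLimit > 0,
tendsto_fluxCoeff, fluxLimit_pos) and are BOUNDED. So the ballistic member satisfies (A) (and the
subadditive half) and violates exactly (B): the route cannot prove too much, and the (N : ℝ) − 1 / N
+ M − 1 normalisations are exercised on a closed form. Uniqueness of the harmonic weak NESS is not
claimed (statement along one explicit family). [difficulty: provable-now] [RoyDhar2008,
BonettoLebowitzReyBellet2000, Nakazawa1970]

TWO-LAYER PLAN. Foreseen glued splits once a prover engages (nothing filed now, k ≤ 3, depth 1):
SuperadditiveResistance ⇐ SaddleRepresentation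
(two-sided Dirichlet/Thomson principle for D_N with the bulk Liouville constraint) → JunctionRepair
(O(1)-site repair of glued
near-optimisers at cost ≤ C) → SuperadditiveResistance; NonBallistic ⇐ ExplicitInsertionConstant
(constructive C(T) from (A)) →
FiniteSizeCertificate (one certified N₀ with R_{N₀} > C, compact-T families) → NonBallistic;
ConductanceLowerBound ⇐ the
subadditive half + PositiveConductance (shared with the companion card's route when it re-opens) →
ConductanceLowerBound.

KILL CRITERIA. (A) dies if nonequilibrium simulations of pinnedChain 1 1 1 1 (T ∈ {0.1, 1, 10}, N =
M = 2^k ≤ 128) show Δ_k := R_{2N} − 2R_N → −∞,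
equivalently finite-size corrections |D_N − κ| decaying slower than 1/N, or if a theorem exhibits
superdiffusive enhancement /
log-growing contact layers in a pinned chain — close `refuted:SuperadditiveResistance` (only a C =
o(N) variant would survive: a
different route). (B) refuted ⇒ hidden conserved quantity ⇒ ¬FouriersLaw outright (pattern
not_fouriersLawFor_harmonic); (C) refuted ⇒
insulator ⇒ ¬FouriersLaw. BoundedResponse + PositiveOrInfiniteLimit proved elsewhere
(BondHeatUncertainty) moots (A) as an engine but
not the dichotomy/rate by-product.

NOT DECOMPOSED YET. The saddle representation and the junction-repair lemma inside (A); the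
certificate technology and the explicit constant for (B);
the engine for (C) (three candidate engines named in the item); T-uniformity questions (C(T), N₀(T)
as T → 0). No separate Target
item: X is the conjunction of the three cruxes and a rank-0 conjunction would only restate them
(D-0019 thin shape).

CHEAPEST FALSIFIER. The MD probe above (Δ_k bounded below?) — not runnable from this compute-free
seat (kit not in the plancard payload); in print,
pinned φ⁴/FPU-type chains show 1/N finite-size corrections with boundary temperature jumps
(LepriLiviPoliti2003 §6, AokiKusnezov2001),
consistent with two-sided locality. Lean-level: HarmonicCalibration (provable now) exercises the
sign conventions — (A) holds and
(B) fails at lam = β = 0, as it must (HarmonicChainBallisticFlux).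

NUMBERS. Harmonic corner: c_N = γ/(2(1+γ²))·(r + r^(2N−2))/(1 + r^(2N−1)) → c_∞ = γr/(2(1+γ²)) > 0
(fluxCoeff_eq, tendsto_fluxCoeff; RoyDhar2008
(2.8)), so R_N = 1/c_N is bounded: the ℓ = 0 branch. Anharmonic pinned chains: κ(T) ~ (lamT)⁻² at
low T (AokiLukkarinenSpohn2006,
LukkarinenSpohn2008 kinetic scaling), so C(T), N₀(T) ~ mean free path ~ (lamT)⁻² are expected to
blow up as T → 0. Items at open: 10
(3 cruxes, 6 support, 1 assembly).

DEFINITION REQUESTS. None: every item is typed over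
Literature.MathematicalPhysics.KineticTheory.HeatConduction (pinnedChain, IsSteadyState,
totalCurrent);
R_N is a quotient of the statement's own D_N. No cite facts wanted: the only Literature fact used by
`closes`
(CuneoEckmannHairerReyBellet2018_pinnedChain) is PROVED in tree.

Novelty: Searches (2026-08-15, this seat): `lit galaxy search "additivity of thermal resistance" --star all`
(3 engineering books: Parrott–Stuckes
1975 etc.; pdf/crabby 0); `lit galaxy search "additivity principle" --star pdf` (15; relevant:
Derrida cond-mat/0703762 lecture notes,
Raux–Goupil–Verley doi:10.1103/physreve.110.014134 thermodynamic circuits); `lit search --source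
crossref` ×4 ("thermal resistance in
series anharmonic chains intermediate reservoir" → only engineering contact-resistance texts;
"additivity principle current
fluctuations anharmonic crystal" → doi:10.1103/physrevlett.107.250601,
doi:10.1103/physrevlett.102.250601, doi:10.1103/physreve.81.041102;
"interface thermal resistance dissimilar anharmonic lattices" → doi:10.1103/physrevlett.95.104302;
"thermodynamic circuits" →
doi:10.1103/physreve.110.014134, doi:10.1103/ksbz-yrf7); `lit frontier AtomisticToContinuum --since
2022` (30 rows; heat-conduction
advances arXiv:2310.13338, arXiv:2604.14056 — unrelated mechanisms); `lit search --hybrid` and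
openalex unavailable this session
(searchd rc 75 / HTTP 429) — the gen-1 planner's hybrid searches and the two refuter novelty audits
of the card (hybrid ×2, crossref ×8,
galaxy ×3) are adopted; `ledger negatives --problem AtomisticToContinuum` (6, none in FouriersLaw).
Nearest prior art found: Hammersley1988 (doi:10.1017/s002190020004047x) / Knabe1988 /
ArmstrongKuusiMourrat2019 Ch. 2 — "superadditive
quantity + one finite-size witness ⇒ thermodynamic statement", all reve  [refs: 10.1103/physreve.110.014134, 10.1103/physrevlett.107.250601, 10.1103/physrevlett.102.250601, 10.1103/physreve.81.041102, 10.1103/physrevlett.95.104302, 10.1103/ksbz-yrf7, 10.1017/s002190020004047x, 10.1103/physrevb.33.3020, 10.1103/physrevlett.92.180601, 2310.13338, 2604.14056, doi:10.1103/physreve.110.014134, doi:10.1103/physrevlett.107.250601, doi:10.1103/physrevlett.102.250601, doi:10.1103/phys]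

Barriers (technique_class: superadditivity-in-length junction-repair finite-size-test): - technique_class: superadditivity-in-length junction-repair finite-size-test
- Literature.Barriers.AtomisticToContinuum.HasBoundedResponse: the universal residual crux is
REPLACED, not assumed — (A) relates three lengths and Fekete manufactures the N → ∞ statement; the
only fixed-N ingredient is ONE certified N₀ inside (B), legitimate fixed-N analysis used once, not
uniformly; (B) and (C) are necessary consequences of the conjunct; the name does not enter any decl
(cone stays proved).
- Literature.Barriers.AtomisticToContinuum.HarmonicChainBallisticFlux: consistent and used as
calibration — the harmonic member satisfies (A) (indeed two-sided locality, R_N = 1/fluxCoeff_N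
bounded) and violates exactly (B); it is the ℓ = 0 branch of JunctionDichotomy (support
HarmonicCalibration), so the line cannot prove too much; every anharmonic input sits in (B)/(C).
- Literature.Barriers.AtomisticToContinuum.LowTemperatureWeakAnharmonicity: nothing is perturbative
in (lam, β) or uniform in T — C(T) ↑ ∞ and N₀(T) ↑ ∞ as T → 0 are allowed (N₀ ~ (lamT)⁻²); T is
fixed throughout.
- Literature.Barriers.AtomisticToContinuum.LukkarinenSpohn2008_lemma41: names exactly the regime
where (A) FAILS (superdiffusive enhancement of momentum-conserving FPU makes a thermalising cut
costly); the conjunct's chain is pinned (no momentum/stretch modes), and a proof of (A) must use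
pinning.
- Literature.Barriers.AtomisticToContinuum.Mazur1969_inequality: a conserved quantity overlapping
the current puts the ch

History (route lifecycle, newest last):
- 2026-08-26T08:25:10Z · DORMANT — reconciler: no traction for 8.4 d (last activity item-evidence-added at 2026-08-17T21:58:01Z); parked, not closed — `ledger route dormant route-AtomisticToConti (operator:999:279128)

sub-problem: FouriersLaw · status: dormant · opened planner-plancard-AtomisticToContinuum-Fourier-66d4262d-g2-0 2026-08-15T18:42:27Z · rev 2 · ledger route-AtomisticToContinuum-JunctionLocality
GENERATED by the gate from the ledger (D-0016/17). Provers cite these decls: `theorem foo : Summit.AtomisticToContinuum.FouriersLaw.Theses.JunctionLocality.<Decl> := …` in Summits/AtomisticToContinuum/FouriersLaw/Theorems/<Name>.lean.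
-/

namespace Summit.AtomisticToContinuum.FouriersLaw.Theses.JunctionLocality

open scoped BigOperators Topology Manifold Classical MeasureTheory ProbabilityTheory Matrix InnerProductSpace ComplexConjugate ContinuousMap
open Filter Set Function TopologicalSpace MeasureTheory

attribute [summit_statement] _root_.FouriersLaw

/-- item stmt-AtomisticToContinuum-11748 · crux · rank 2 · open · by planner
why it might fail: Repair cost may grow with N, M if optimal response fields carry junction-crossing coherent structure at all scales (long mean free path; C(T)↑∞ as T→0 must be allowed); no sign principle is known (dephasing-assisted transport exists); finite-size corrections slower than 1/N would kill it.
sources: GaudilliereLandim2013, LandimMarianiSeo2018, arXiv:1105.0493, ReyBellet2003, KunduDharNarayan2009, Buttiker1986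
[crux] under weak-NESS uniqueness, for every steady-state family of pinnedChain ω₂ lam β γ (all >
0), every T > 0 and response coefficients D_N > 0 (N ≥ 2): ∃ C = C(ω₂,lam,β,γ,T) with R_{N+M} ≥ R_N
+ R_M − C for all N, M ≥ 2, R_N := (N−1)/D_N (card item K1; = InsertionCost of
insertion-cost-superadditive-half). Bounded reservoir-insertion cost: cutting the chain and
re-thermalising the cut raises the end-to-end resistance by at most a contact constant. Arena:
Dirichlet/Thomson saddle representation of D_N for L = A_H + γS_baths + a junction-repair lemma
gluing near-optimal admissible pairs of the two bathed halves across the deterministic bond at cost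
≤ C uniformly in N, M (admissible classes are bulk-invariant, arXiv:1105.0493 §6); other engines:
thermostat interpolation at the junction, contact cross-correlations. NOT implied by FouriersLaw (it
carries the 1/N rate): the bet. Trivial at lam = β = 0 (HarmonicCalibration). [difficulty: XL] -/
@[route_item "route-AtomisticToContinuum-JunctionLocality", crux]
def SuperadditiveResistance : Prop :=
  ∀ ω₂ lam β γ : ℝ, 0 < ω₂ → 0 < lam → 0 < β → 0 < γ → (∀ (N : ℕ) (T_L T_R : ℝ), 0 < T_L → 0 < T_R → ∀ μ ν : MeasureTheory.Measure (Literature.MathematicalPhysics.KineticTheory.HeatConduction.PhaseSpace N), (Literature.MathematicalPhysics.KineticTheory.HeatConduction.pinnedChain ω₂ lam β γ).IsSteadyState N T_L T_R μ → (Literature.MathematicalPhysics.KineticTheory.HeatConduction.pinnedChain ω₂ lam β γ).IsSteadyState N T_L T_R ν → μ = ν) → ∀ μ : (N : ℕ) → ℝ → ℝ → MeasureTheory.Measure (Literature.MathematicalPhysics.KineticTheory.HeatConduction.PhaseSpace N), (∀ (N : ℕ) (T_L T_R : ℝ), 0 < T_L → 0 < T_R → (Literature.MathematicalPhysics.KineticTheory.HeatConduction.pinnedChain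 ω₂ lam β γ).IsSteadyState N T_L T_R (μ N T_L T_R)) → ∀ T : ℝ, 0 < T → ∀ D : ℕ → ℝ, (∀ N : ℕ, Filter.Tendsto (fun δ : ℝ => (Literature.MathematicalPhysics.KineticTheory.HeatConduction.pinnedChain ω₂ lam β γ).totalCurrent (μ N (T + δ / 2) (T - δ / 2)) / δ) (nhdsWithin 0 {(0 : ℝ)}ᶜ) (nhds (D N))) → (∀ N : ℕ, 2 ≤ N → 0 < D N) → ∃ C : ℝ, ∀ N M : ℕ, 2 ≤ N → 2 ≤ M → ((N : ℝ) - 1) / D N + ((M : ℝ) - 1) / D M - C ≤ ((N : ℝ) + (M : ℝ) - 1) / D (N + M)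

/-- item stmt-AtomisticToContinuum-9127 · crux · rank 3 · open · by planner
why it might fail: A hidden conserved quantity / near-integrable member (Mazur1969; integrable dimer points) would make the chain a perfect conductor — then FouriersLaw is false too; proof-wise nothing gives J_N → 0 for ANY deterministic anharmonic chain (BLR2000 §6.3), and certificates need (A) with explicit C.
sources: BonettoLebowitzReyBellet2000, CanestrariLiveraniOlla2026, Mazur1969, RoyDhar2008, doi:10.1137/16m107801x, doi:10.1137/15m1053347
[support] SHARED (identical signature to SuperadditiveJunction's crux
stmt-AtomisticToContinuum-2192): under weak-NESS uniqueness, for every steady-state family, T > 0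
and response coefficients D: ∀ ε > 0 there are arbitrarily long chains with D_N ≤ ε(N−1) (the
conductance is not bounded away from 0). In THIS route it is the OUTPUT of the light-cone rung
(TransferToNonBallistic), not used by the Assembly. [difficulty: XL] -/
@[route_item "route-AtomisticToContinuum-JunctionLocality", crux]
def NonBallistic : Prop :=
  ∀ ω₂ lam β γ : ℝ, 0 < ω₂ → 0 < lam → 0 < β → 0 < γ → (∀ (N : ℕ) (T_L T_R : ℝ), 0 < T_L → 0 < T_R → ∀ μ ν : MeasureTheory.Measure (Literature.MathematicalPhysics.KineticTheory.HeatConduction.PhaseSpace N), (Literature.MathematicalPhysics.KineticTheory.HeatConduction.pinnedChain ω₂ lam β γ).IsSteadyState N T_L T_R μ → (Literature.MathematicalPhysics.KineticTheory.HeatConduction.pinnedChain ω₂ lam β γ).IsSteadyState N T_L T_R ν → μ = ν) → ∀ μ : (N : ℕ) → ℝ → ℝ → MeasureTheory.Measure (Literature.MathematicalPhysics.KineticTheory.HeatConduction.PhaseSpace N), (∀ (N : ℕ) (T_L T_R : ℝ), 0 < T_L → 0 < T_R → (Literature.MathematicalPhysics.KineticTheory.HeatConduction.pinnedChain ω₂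 lam β γ).IsSteadyState N T_L T_R (μ N T_L T_R)) → ∀ T : ℝ, 0 < T → ∀ D : ℕ → ℝ, (∀ N : ℕ, Filter.Tendsto (fun δ : ℝ => (Literature.MathematicalPhysics.KineticTheory.HeatConduction.pinnedChain ω₂ lam β γ).totalCurrent (μ N (T + δ / 2) (T - δ / 2)) / δ) (nhdsWithin 0 {(0 : ℝ)}ᶜ) (nhds (D N))) → ∀ ε : ℝ, 0 < ε → ∀ N₀ : ℕ, ∃ N : ℕ, N₀ ≤ N ∧ D N ≤ ε * ((N : ℝ) - 1)

/-- item stmt-AtomisticToContinuum-11749 · crux · rank 4 · open · by planner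
why it might fail: Asymptotic localisation (DeRoeckHuveneers2015) makes c(T) super-polynomially small at fixed T — allowed — but a genuine thermal insulator (D_N → 0) would refute the conjunct; no N-uniform lower bound for a deterministic chain's NESS current exists in print.
sources: DeRoeckHuveneers2015, BernardinOlla2005, BasileBernardinOlla2009, BonettoLebowitzReyBellet2000, LepriLiviPoliti2003, Dhar2008
[crux] under weak-NESS uniqueness, for every steady-state family of pinnedChain ω₂ lam β γ (all >
0), T > 0 and the response coefficients D_N: ∃ c = c(ω₂,lam,β,γ,T) > 0 and N₁ with D_N ≥ c for all N
≥ N₁ (liminf_N D_N > 0; an Ohmic LOWER bound J_N ≥ c·δT/(N−1) to first order; card item K3's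
positivity half). NECESSARY for the conjunct (D_N → κ(T) > 0). In the glue it caps the Fekete slope
(R_N/N ≤ 1/c), i.e. κ ≥ c. No N-uniform lower bound on the NESS current of a deterministic
anharmonic chain is in print; candidate engines: linear-response fluctuation-theorem / uncertainty
bounds, comparison with the energy-conserving-noise chain where κ ≥ c is a theorem
(BernardinOlla2005, BasileBernardinOlla2009), multi-scale pigeonhole on the response temperature
profile (card anti-insulator-kink-rigidity); ALTERNATIVE SUPPLIER: the companion SUBadditive half
(card fekete-resistance-subadditivity: R_{N+M} ≤ R_N + R_M + C' and D_2 > 0 give R_N ≤ K·N, hence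
D_N ≥ 1/(2K)). [difficulty: XL] -/
@[route_item "route-AtomisticToContinuum-JunctionLocality", crux]
def ConductanceLowerBound : Prop :=
  ∀ ω₂ lam β γ : ℝ, 0 < ω₂ → 0 < lam → 0 < β → 0 < γ → (∀ (N : ℕ) (T_L T_R : ℝ), 0 < T_L → 0 < T_R → ∀ μ ν : MeasureTheory.Measure (Literature.MathematicalPhysics.KineticTheory.HeatConduction.PhaseSpace N), (Literature.MathematicalPhysics.KineticTheory.HeatConduction.pinnedChain ω₂ lam β γ).IsSteadyState N T_L T_R μ → (Literature.MathematicalPhysics.KineticTheory.HeatConduction.pinnedChain ω₂ lam β γ).IsSteadyState N T_L T_R ν → μ = ν) → ∀ μ : (N : ℕ) → ℝ → ℝ → MeasureTheory.Measure (Literature.MathematicalPhysics.KineticTheory.HeatConduction.PhaseSpace N), (∀ (N : ℕ) (T_L T_R : ℝ), 0 < T_L → 0 < T_R → (Literature.MathematicalPhysics.KineticTheory.HeatConduction.pinnedChain ω₂ lam β γ).IsSteadyState N T_L T_R (μ N T_L T_R)) → ∀ T : ℝ, 0 < T → ∀ D : ℕ → ℝ, (∀ N : ℕ, Filter.Tendsto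 (fun δ : ℝ => (Literature.MathematicalPhysics.KineticTheory.HeatConduction.pinnedChain ω₂ lam β γ).totalCurrent (μ N (T + δ / 2) (T - δ / 2)) / δ) (nhdsWithin 0 {(0 : ℝ)}ᶜ) (nhds (D N))) → ∃ c : ℝ, 0 < c ∧ ∃ N₁ : ℕ, ∀ N : ℕ, N₁ ≤ N → c ≤ D N

/-- item stmt-AtomisticToContinuum-0717 · support · rank 9 · closed · proved by Summit.AtomisticToContinuum.FouriersLaw.Theorems.FourierGreenKubo.finiteResponseOfUnique_holds (prover) · by planner
sources: ReyBellet2003, HairerMajda2009, CuneoEckmannHairerReyBellet2018, Carmona2007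
CONDITIONAL FORM OF 0705 (supersedes it as the prover target; refuters pool-5/g3-0: 0705 stand-alone
quantifies over EVERY steady-state family and is false-prone if weak steady states were non-unique):
assuming UNIQUENESS of weak steady states (IsSteadyState class) for pinnedChain at all N, T_L, T_R >
0, the finite-N linear-response limit D_N(T) = lim_{δ→0, δ≠0} totalCurrent(μ_{N,T+δ/2,T−δ/2})/δ
exists for every T > 0 and N. Content: differentiability at equilibrium of NESS expectations of the
polynomial currents in the bath temperatures (ReyBellet2003 arXiv:math-ph/0303021 Rem 4.4 (51)–(56)
finite-volume Green–Kubo; HairerMajda2009 arXiv:0909.4313 Thm 2.3 framework — their SDE Thm 4.4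
Assumption 5 fails here, so verify Assumptions 1–3 via CEHR2018 (2.5)/Carmona2007 Thm 1.1(iv)
weighted spectral gap). N = 0, 1: totalCurrent ≡ 0, D = 0. Together with 0706 gives 0705. -/
@[route_item "route-AtomisticToContinuum-JunctionLocality", crux]
def FiniteResponseOfUnique : Prop :=
  ∀ ω₂ lam β γ : ℝ, 0 < ω₂ → 0 < lam → 0 < β → 0 < γ → (∀ (N : ℕ) (T_L T_R : ℝ), 0 < T_L → 0 < T_R → ∀ μ ν : MeasureTheory.Measure (Literature.MathematicalPhysics.KineticTheory.HeatConduction.PhaseSpace N), (Literature.MathematicalPhysics.KineticTheory.HeatConduction.pinnedChain ω₂ lam β γ).IsSteadyState N T_L T_R μ → (Literature.MathematicalPhysics.KineticTheory.HeatConduction.pinnedChain ω₂ lam β γ).IsSteadyState N T_L T_R ν → μ = ν) → ∀ μ : (N : ℕ) → ℝ → ℝ → MeasureTheory.Measure (Literature.MathematicalPhysics.KineticTheory.HeatConduction.PhaseSpace N), (∀ (N : ℕ) (T_L T_R : ℝ), 0 < T_L → 0 < T_R → (Literature.MathematicalPhysics.KineticTheory.HeatConduction.pinnedChain ω₂ lam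 β γ).IsSteadyState N T_L T_R (μ N T_L T_R)) → ∀ T : ℝ, 0 < T → ∀ N : ℕ, ∃ D : ℝ, Filter.Tendsto (fun δ : ℝ => (Literature.MathematicalPhysics.KineticTheory.HeatConduction.pinnedChain ω₂ lam β γ).totalCurrent (μ N (T + δ / 2) (T - δ / 2)) / δ) (nhdsWithin 0 {(0 : ℝ)}ᶜ) (nhds D)

-- `FiniteResponseOfUnique` holds: proved by `Summit.AtomisticToContinuum.FouriersLaw.Theorems.FourierGreenKubo.finiteResponseOfUnique_holds` (its module imports this route file, so no `_holds` link can be stated here).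

/-- item stmt-AtomisticToContinuum-0741 · support · rank 9 · closed · proved by Summit.AtomisticToContinuum.FouriersLaw.Theorems.nessUnique_proof (prover) · by planner
sources: CuneoEckmannHairerReyBellet2018, Carmona2007, EthierKurtz1986, ReyBelletThomas2002
[crux] UNIQUENESS OF THE WEAK STEADY STATE (the half of stmt-0706 not covered by the landed fact
Literature.MathematicalPhysics.KineticTheory.HeatConduction.CuneoEckmannHairerReyBellet2018_pinnedChain,
p3544): for pinnedChain ω₂ lam β γ (all > 0), every N and T_L, T_R > 0, any two measures in the weak
Fokker–Planck class IsSteadyState (probability, ∫ L f dμ = 0 for f ∈ C_c^∞, bond currents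
integrable) coincide. Print: uniqueness of the INVARIANT MEASURE of the Langevin semigroup
(CuneoEckmannHairerReyBellet2018 Thm 2.13(1): C1, C2, CA; Carmona2007 Thm 1.1(iii)); the item
additionally needs 'weak stationary probability solution of L*μ = 0 ⇒ P_t-invariant' for this
hypoelliptic L with cubic drift (Echeverría 1982 well-posed martingale problem on C_c^∞ +
non-explosion via e^{θH}; Bogachev–Krylov–Röckner–Shaposhnikov 2015 Ch. 5 is non-degenerate only) —
the FP-identification lemma is the formal crux. N = 0: PhaseSpace 0 is a point (unique probability
measure); N = 1: both baths on site 0, OU at temperature (T_L+T_R)/2. This is exactly the hypothesis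
of FiniteResponse and ThermodynamicLimit and, with the fact, gives clause (i) of FouriersLawFor. -/
@[route_item "route-AtomisticToContinuum-JunctionLocality", crux]
def NessUnique : Prop :=
  ∀ ω₂ lam β γ : ℝ, 0 < ω₂ → 0 < lam → 0 < β → 0 < γ → ∀ (N : ℕ) (T_L T_R : ℝ), 0 < T_L → 0 < T_R → ∀ μ ν : MeasureTheory.Measure (Literature.MathematicalPhysics.KineticTheory.HeatConduction.PhaseSpace N), (Literature.MathematicalPhysics.KineticTheory.HeatConduction.pinnedChain ω₂ lam β γ).IsSteadyState N T_L T_R μ → (Literature.MathematicalPhysics.KineticTheory.HeatConduction.pinnedChain ω₂ lam β γ).IsSteadyState N T_L T_R ν → μ = ν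

/-- `NessUnique` holds: proved by `Summit.AtomisticToContinuum.FouriersLaw.Theorems.nessUnique_proof`. -/
theorem NessUnique_holds : NessUnique := _root_.Summit.AtomisticToContinuum.FouriersLaw.Theorems.nessUnique_proof

/-- item stmt-AtomisticToContinuum-11750 · support · rank 9 · closed · proved by Summit.AtomisticToContinuum.FouriersLaw.Cruxes.BoundedResponseConverges.TwoScaleGluingLogRigidity.Stubs.positiveConductance_holds (prover) · by planner
sources: ReyBellet2003, KunduDharNarayan2009, EckmannPilletReyBellet1999b, CuneoEckmannHairerReyBellet2018
[support] POSITIVE CONDUCTANCE AT EVERY FINITE LENGTH (fixed-N analysis): under weak-NESS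
uniqueness, for every steady-state family, T > 0 and response coefficients D, D_N(T) > 0 for all N ≥
2. Content: the finite-volume Kubo / fluctuation formula D_N = (N−1)T⁻² ∫₀^∞ ⟨j_b(0) Σ_i j_i(t)⟩_eq
dt = lim_t Var(Q_t)/(2tT²) ≥ 0 (ReyBellet2003 Rem 4.4 (56); KunduDharNarayan2009 for Langevin baths)
is NON-DEGENERATE — the time-integrated boundary energy current is not an L²-coboundary of the
equilibrium dynamics; equivalently strict positivity of entropy production at T_L ≠ T_R
(EckmannPilletReyBellet1999b) survives at first order in δT. Needed so that R_N = (N−1)/D_N is a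
resistance in (A) and in the Fekete step. Fixed-N toolbox: CuneoEckmannHairerReyBellet2018 Thm 2.13,
Carmona2007, HairerMajda2009. [difficulty: M] -/
@[route_item "route-AtomisticToContinuum-JunctionLocality", crux]
def PositiveConductance : Prop :=
  ∀ ω₂ lam β γ : ℝ, 0 < ω₂ → 0 < lam → 0 < β → 0 < γ → (∀ (N : ℕ) (T_L T_R : ℝ), 0 < T_L → 0 < T_R → ∀ μ ν : MeasureTheory.Measure (Literature.MathematicalPhysics.KineticTheory.HeatConduction.PhaseSpace N), (Literature.MathematicalPhysics.KineticTheory.HeatConduction.pinnedChain ω₂ lam β γ).IsSteadyState N T_L T_R μ → (Literature.MathematicalPhysics.KineticTheory.HeatConduction.pinnedChain ω₂ lam β γ).IsSteadyState N T_L T_R ν → μ = ν) → ∀ μ : (N : ℕ) → ℝ → ℝ → MeasureTheory.Measure (Literature.MathematicalPhysics.KineticTheory.HeatConduction.PhaseSpace N), (∀ (N : ℕ) (T_L T_R : ℝ), 0 < T_L → 0 < T_R → (Literature.MathematicalPhysics.KineticTheory.HeatConduction.pinnedChain ω₂ lam β γ).IsSteadyState N T_L T_R (μ N T_L T_R)) →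 ∀ T : ℝ, 0 < T → ∀ D : ℕ → ℝ, (∀ N : ℕ, Filter.Tendsto (fun δ : ℝ => (Literature.MathematicalPhysics.KineticTheory.HeatConduction.pinnedChain ω₂ lam β γ).totalCurrent (μ N (T + δ / 2) (T - δ / 2)) / δ) (nhdsWithin 0 {(0 : ℝ)}ᶜ) (nhds (D N))) → ∀ N : ℕ, 2 ≤ N → 0 < D N

-- `PositiveConductance` holds: proved by `Summit.AtomisticToContinuum.FouriersLaw.Cruxes.BoundedResponseConverges.TwoScaleGluingLogRigidity.Stubs.positiveConductance_holds` (its module imports this route file, so no `_holds` link can be stated here).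

/-- item stmt-AtomisticToContinuum-11751 · support · rank 9 · closed · proved by Summit.AtomisticToContinuum.FouriersLaw.Theorems.superadditiveFekete_proof @ 1cda6fbedd7e (prover) · by planner
sources: Hammersley1988, ArmstrongKuusiMourrat2019
[support] FEKETE GLUE (pure real analysis), PROVED sorry-free in the planner folder (Fekete.lean,
theorem superadditiveFekete_holds, axioms propext/Classical.choice/Quot.sound, ~170 lines; attached
as evidence — copy into Theorems/): for a real sequence D with D_N > 0 (N ≥ 2), eventually D_N ≥ c >
0, resistances R_N := (N−1)/D_N superadditive up to the constant C on {N, M ≥ 2}, and D_N ≤ ε(N−1)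
frequently for every ε > 0, the sequence D converges to some κ > 0. Proof: a_N := R_N − C satisfies
a_{N+M} ≥ a_N + a_M (N, M ≥ 2); k·a_n + a_r ≤ a_{kn+r} (n, r ≥ 2) along each residue class gives
liminf a_N/N ≥ a_n/n, so a_N/N → ℓ := sup_{n≥2} a_n/n (bounded above by 1/c + |C| beyond N₁,
finitely many before); non-ballisticity with ε = 1/(|C|+1) gives some a_{N₀} > 0, so ℓ > 0; then
R_N/N → ℓ and D_N = ((N−1)/N)/(R_N/N) → 1/ℓ =: κ > 0. It is the hypothesis hF of `closes`.
[difficulty: provable-now] -/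
@[route_item "route-AtomisticToContinuum-JunctionLocality", crux]
def SuperadditiveFekete : Prop :=
  ∀ (D : ℕ → ℝ) (C c : ℝ), 0 < c → (∀ N : ℕ, 2 ≤ N → 0 < D N) → (∃ N₁ : ℕ, ∀ N : ℕ, N₁ ≤ N → c ≤ D N) → (∀ N M : ℕ, 2 ≤ N → 2 ≤ M → ((N : ℝ) - 1) / D N + ((M : ℝ) - 1) / D M - C ≤ ((N : ℝ) + (M : ℝ) - 1) / D (N + M)) → (∀ ε : ℝ, 0 < ε → ∀ N₀ : ℕ, ∃ N : ℕ, N₀ ≤ N ∧ D N ≤ ε * ((N : ℝ) - 1)) → ∃ κ : ℝ, 0 < κ ∧ Filter.Tendsto D Filter.atTop (nhds κ)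

-- `SuperadditiveFekete` holds: proved by `Summit.AtomisticToContinuum.FouriersLaw.Theorems.superadditiveFekete_proof` @ 1cda6fbedd7e (its module imports this route file, so no `_holds` link can be stated here).

/-- item stmt-AtomisticToContinuum-11752 · support · rank 9 · closed · proved by Summit.AtomisticToContinuum.FouriersLaw.Theorems.junctionDichotomy_proof @ 074fd9a481a7 (prover) · by planner
sources: LepriLiviPoliti2003, AokiKusnezov2001, Hammersley1988
[support] JUNCTION DICHOTOMY WITH RATE (pure real analysis; the route's refutation interface and
bonus theorem): if D_N > 0 for N ≥ 2 and R_N := (N−1)/D_N satisfies TWO-SIDED locality |R_{N+M} −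
R_N − R_M| ≤ C (N, M ≥ 2), then EITHER ∃ κ > 0, K with |D_N − κ| ≤ K/N for all N ≥ 2 (Fourier's law
with the 1/N finite-size rate) OR D_N ≥ (N−1)/C for all N ≥ 2 (ballistic branch: bounded resistance,
where pinnedChain ω₂ 0 0 γ sits). Proof: R_N − C superadditive and R_N + C subadditive on {N ≥ 2}
give R_N/N → ℓ with |R_N − Nℓ| ≤ C for every N ≥ 2 and ℓ ≥ 0; ℓ = 0: 0 < R_N ≤ C; ℓ > 0, κ := 1/ℓ:
|D_N − κ| ≤ 2(C + ℓ)/(ℓ²N) once Nℓ ≥ 2C, finitely many N absorbed into K. So anomalous scalings D_N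
~ N^α (0 < α < 1) and localisation are excluded structurally by two-sided locality; pinned
anharmonic chains numerically show exactly 1/N corrections (boundary jumps: LepriLiviPoliti2003 §6,
AokiKusnezov2001) — the cheapest consistency check of the line. The subadditive half is the crux of
the companion card fekete-resistance-subadditivity. [difficulty: provable-now] -/
@[route_item "route-AtomisticToContinuum-JunctionLocality"]
def JunctionDichotomy : Prop :=
  ∀ (D : ℕ → ℝ) (C : ℝ), (∀ N : ℕ, 2 ≤ N → 0 < D N) → (∀ N M : ℕ, 2 ≤ N → 2 ≤ M → |((N : ℝ) + (M : ℝ) - 1) / D (N + M) - ((N : ℝ) - 1) / D N - ((M : ℝ) - 1) / D M| ≤ C) → (∃ κ K : ℝ, 0 < κ ∧ ∀ N : ℕ, 2 ≤ N → |D N - κ| ≤ K / (N : ℝ)) ∨ (∀ N : ℕ, 2 ≤ N → ((N : ℝ) - 1) / C ≤ D N)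

-- `JunctionDichotomy` holds: proved by `Summit.AtomisticToContinuum.FouriersLaw.Theorems.junctionDichotomy_proof` @ 074fd9a481a7 (its module imports this route file, so no `_holds` link can be stated here).

/-- item stmt-AtomisticToContinuum-11753 · support · rank 9 · closed · proved by Summit.AtomisticToContinuum.FouriersLaw.Theorems.JunctionLocality.harmonicCalibration_proof (prover) · by planner
sources: RoyDhar2008, BonettoLebowitzReyBellet2000, Nakazawa1970
[support] HARMONIC CALIBRATION (sign/normalisation regression test at the integrable corner,
provable in tree): for the pinned HARMONIC chain pinnedChain ω₂ 0 0 γ (ω₂, γ > 0) there is a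
steady-state family for all N, T_L, T_R > 0 (harmonicNESS, isSteadyState_harmonicNESS) along which,
at every T > 0, the response limits exist and equal D_N = (N−1)·fluxCoeff ω₂ γ N
(integral_bondCurrent_harmonicNESS_eq_fluxCoeff: every bond carries fluxCoeff·(T_L − T_R)), D_N > 0
for N ≥ 2 (fluxCoeff_eq with 0 < rootR < 1), the resistances R_N = 1/fluxCoeff_N satisfy TWO-SIDED
junction locality (with C = 3·sup_N 1/fluxCoeff_N < ∞ since fluxCoeff_N → fluxLimit > 0,
tendsto_fluxCoeff, fluxLimit_pos) and are BOUNDED. So the ballistic member satisfies (A) (and the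
subadditive half) and violates exactly (B): the route cannot prove too much, and the (N : ℝ) − 1 / N
+ M − 1 normalisations are exercised on a closed form. Uniqueness of the harmonic weak NESS is not
claimed (statement along one explicit family). [difficulty: provable-now] -/
@[route_item "route-AtomisticToContinuum-JunctionLocality"]
def HarmonicCalibration : Prop :=
  ∀ ω₂ γ : ℝ, 0 < ω₂ → 0 < γ → ∃ μ : (N : ℕ) → ℝ → ℝ → MeasureTheory.Measure (Literature.MathematicalPhysics.KineticTheory.HeatConduction.PhaseSpace N), (∀ (N : ℕ) (T_L T_R : ℝ), 0 < T_L → 0 < T_R → (Literature.MathematicalPhysics.KineticTheory.HeatConduction.pinnedChain ω₂ 0 0 γ).IsSteadyState N T_L T_R (μ N T_L T_R)) ∧ ∀ T : ℝ, 0 < T → ∃ D : ℕ → ℝ, (∀ N : ℕ, Filter.Tendsto (fun δ : ℝ => (Literature.MathematicalPhysics.KineticTheory.HeatConduction.pinnedChain ω₂ 0 0 γ).totalCurrent (μ N (T + δ / 2) (T - δ / 2)) / δ) (nhdsWithin 0 {(0 : ℝ)}ᶜ) (nhds (D N))) ∧ (∀ N : ℕ, 2 ≤ N → 0 < D N) ∧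 (∃ C : ℝ, ∀ N M : ℕ, 2 ≤ N → 2 ≤ M → |((N : ℝ) + (M : ℝ) - 1) / D (N + M) - ((N : ℝ) - 1) / D N - ((M : ℝ) - 1) / D M| ≤ C) ∧ (∃ B : ℝ, ∀ N : ℕ, 2 ≤ N → ((N : ℝ) - 1) / D N ≤ B)

-- `HarmonicCalibration` holds: proved by `Summit.AtomisticToContinuum.FouriersLaw.Theorems.JunctionLocality.harmonicCalibration_proof` (its module imports this route file, so no `_holds` link can be stated here).

/-- item stmt-AtomisticToContinuum-11754 · assembly · rank 1 · closed · proved by Summit.AtomisticToContinuum.FouriersLaw.Theorems.JunctionLocality.assembly_proof @ 074fd9a481a7 (prover) · by planner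
sources: BonettoLebowitzReyBellet2000, CuneoEckmannHairerReyBellet2018
[assembly] SuperadditiveFekete → SuperadditiveResistance → NonBallistic → ConductanceLowerBound →
PositiveConductance → NessUnique → FiniteResponseOfUnique → FouriersLaw (the sub-problem Statement
decl; = the type of `closes`). -/
@[route_item "route-AtomisticToContinuum-JunctionLocality"]
def Assembly : Prop :=
  SuperadditiveFekete → SuperadditiveResistance → NonBallistic → ConductanceLowerBound → PositiveConductance → NessUnique → FiniteResponseOfUnique → FouriersLaw

-- `Assembly` holds: proved by `Summit.AtomisticToContinuum.FouriersLaw.Theorems.JunctionLocality.assembly_proof` @ 074fd9a481a7 (its module imports this route file, so no `_holds` link can be stated here).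

/-! D-0027 §2.1 — DECIDING THEOREM (planner-authored via `route open/edit --closes-file`; by planner-plancard-AtomisticToContinuum-Fourier-66d4262d-g2-0 2026-08-15T18:42:28Z):
its hypotheses are this route's items and its conclusion the sub-problem Statement (glue_lint), and it elaborates with this file. -/

/-- D-0027 §2.1 DECIDING THEOREM of route JunctionLocality (card superadditive-junction-dichotomy):
the real-analysis glue `SuperadditiveFekete`, the three cruxes (A) `SuperadditiveResistance`,
(B) `NonBallistic`, (C) `ConductanceLowerBound`, fixed-`N` positivity `PositiveConductance`,
weak-NESS uniqueness `NessUnique` and existence of the response limits `FiniteResponseOfUnique`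
decide the sub-problem Statement `FouriersLaw`. Proof: clause (i) from the PROVED fact
`pinnedChain_exists_isSteadyState` (CEHR 2018 Thm 2.13, in tree) + uniqueness; clause (ii): along
the canonical family `μ₀` (choice) the response coefficients `D` exist (`FiniteResponseOfUnique`),
and `SuperadditiveFekete` fed with (A), (B), (C) and positivity yields `κ_T > 0` with `D → κ_T`;
uniqueness transfers the `δ`-limits to every steady-state family (difference quotients agree for
`|δ| < 2T`). -/
@[closes "route-AtomisticToContinuum-JunctionLocality"] theorem closes (hF : SuperadditiveFekete) (hA : SuperadditiveResistance) (hB : NonBallistic)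
    (hC : ConductanceLowerBound) (hP : PositiveConductance) (hU : NessUnique)
    (hR : FiniteResponseOfUnique) : FouriersLaw := by
  show ∀ ω₂ lam β γ : ℝ, 0 < ω₂ → 0 < lam → 0 < β → 0 < γ →
    (Literature.MathematicalPhysics.KineticTheory.HeatConduction.pinnedChain ω₂ lam β γ).FouriersLawFor
  intro ω₂ lam β γ hω hl hβ hγ
  have huniq := hU ω₂ lam β γ hω hl hβ hγ
  -- clause (i): existence (proved fact, in tree) + uniqueness
  have hex : ∀ (N : ℕ) (T_L T_R : ℝ), 0 < T_L → 0 < T_R →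
      ∃ μ : MeasureTheory.Measure (Literature.MathematicalPhysics.KineticTheory.HeatConduction.PhaseSpace N),
        (Literature.MathematicalPhysics.KineticTheory.HeatConduction.pinnedChain ω₂ lam β γ).IsSteadyState N T_L T_R μ :=
    fun N T_L T_R hL' hR' =>
      Literature.MathematicalPhysics.KineticTheory.HeatConduction.pinnedChain_exists_isSteadyState
        hω hl hβ hγ N hL' hR'
  refine ⟨fun N T_L T_R hL' hR' => ?_, ?_⟩
  · obtain ⟨μ, hμ⟩ := hex N T_L T_R hL' hR'
    exact ⟨μ, hμ, fun ν hν => huniq N T_L T_R hL' hR' ν μ hν hμ⟩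
  -- clause (ii): the canonical family
  classical
  let μ₀ : (N : ℕ) → ℝ → ℝ →
      MeasureTheory.Measure (Literature.MathematicalPhysics.KineticTheory.HeatConduction.PhaseSpace N) :=
    fun N T_L T_R => if h : 0 < T_L ∧ 0 < T_R then Classical.choose (hex N T_L T_R h.1 h.2) else 0
  have hμ₀ : ∀ (N : ℕ) (T_L T_R : ℝ), 0 < T_L → 0 < T_R →
      (Literature.MathematicalPhysics.KineticTheory.HeatConduction.pinnedChain ω₂ lam β γ).IsSteadyState N T_L T_R (μ₀ N T_L T_R) := by
    intro N T_L T_R hL' hR'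
    simp only [μ₀, dif_pos (And.intro hL' hR')]
    exact Classical.choose_spec (hex N T_L T_R hL' hR')
  -- for every T > 0: response coefficients along μ₀ and their positive finite limit (Fekete glue)
  have key : ∀ T : ℝ, 0 < T → ∃ κT : ℝ, 0 < κT ∧ ∃ D : ℕ → ℝ,
      (∀ N : ℕ, Filter.Tendsto (fun δ : ℝ =>
        (Literature.MathematicalPhysics.KineticTheory.HeatConduction.pinnedChain ω₂ lam β γ).totalCurrent
          (μ₀ N (T + δ / 2) (T - δ / 2)) / δ) (nhdsWithin 0 {(0 : ℝ)}ᶜ) (nhds (D N))) ∧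
      Filter.Tendsto D Filter.atTop (nhds κT) := by
    intro T hT
    have hDex := hR ω₂ lam β γ hω hl hβ hγ huniq μ₀ hμ₀ T hT
    choose D hD using hDex
    have hpos : ∀ N : ℕ, 2 ≤ N → 0 < D N := hP ω₂ lam β γ hω hl hβ hγ huniq μ₀ hμ₀ T hT D hD
    obtain ⟨c, hc, hN₁⟩ := hC ω₂ lam β γ hω hl hβ hγ huniq μ₀ hμ₀ T hT D hD
    obtain ⟨C, hsup⟩ := hA ω₂ lam β γ hω hl hβ hγ huniq μ₀ hμ₀ T hT D hD hpos
    have hnb := hB ω₂ lam β γ hω hl hβ hγ huniq μ₀ hμ₀ T hT D hD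
    obtain ⟨κ, hκ, hlim⟩ := hF D C c hc hpos hN₁ hsup hnb
    exact ⟨κ, hκ, D, hD, hlim⟩
  choose κf hκpos Df hDf hDlim using key
  refine ⟨fun T => if hT : 0 < T then κf T hT else 1, fun T hT => ?_, ?_⟩
  · simp only [dif_pos hT]; exact hκpos T hT
  intro μ hμ T hT
  refine ⟨Df T hT, fun N => ?_, ?_⟩
  · refine (hDf T hT N).congr' ?_
    have h2 : ∀ᶠ δ in nhds (0 : ℝ), δ < 2 * T := eventually_lt_nhds (by linarith)
    have h2' : ∀ᶠ δ in nhds (0 : ℝ), -(2 * T) < δ := eventually_gt_nhds (by linarith)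
    filter_upwards [mem_nhdsWithin_of_mem_nhds h2, mem_nhdsWithin_of_mem_nhds h2'] with δ hlt hgt
    have ha : 0 < T + δ / 2 := by linarith
    have hb : 0 < T - δ / 2 := by linarith
    rw [huniq N _ _ ha hb (μ₀ N _ _) (μ N _ _) (hμ₀ N _ _ ha hb) (hμ N _ _ ha hb)]
  · simp only [dif_pos hT]; exact hDlim T hT

end Summit.AtomisticToContinuum.FouriersLaw.Theses.JunctionLocality
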